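/-
Copyright: harness Literature vendoring. Source: Krüger–Kusumaatmaja–Kuzmin–Shardt–Silva–Viggen,
*The Lattice Boltzmann Method: Principles and Practice* (Springer GTP, 2017), §3.4.7.
-/
import Mathlib
import HarnessLib

/-!
# Lattice Boltzmann velocity sets D1Q3, D2Q9, D3Q27 and their isotropy conditions

Krüger et al. [cite: KrugerEtAl2017, §3.4.7.2 eq. (3.60); §3.4.7.3 Table 3.1–3.3] list the conditions a
discrete velocity set `{(w_i, c_i)}` must satisfy to serve as a Navier–Stokes lattice Boltzmann
velocity set: normalisation `∑ w_i = 1`, vanishing odd moments, second-moment isotropy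
`∑ w_i c_iα c_iβ = c_s² δ_αβ`, fourth-moment isotropy
`∑ w_i c_iα c_iβ c_iγ c_iμ = c_s⁴ (δ_αβ δ_γμ + δ_αγ δ_βμ + δ_αμ δ_βγ)`, vanishing fifth moments, and
`w_i ≥ 0`, with `c_s² = 1/3` for all the standard sets (Table 3.1).  This file defines the explicit
sets D1Q3 (Table 3.2), D2Q9 (Table 3.3) and D3Q27 (as the tensor product of three copies of D1Q3, as
stated in §3.4.7.2 of the book; weights 8/27, 2/27, 1/54, 1/216 as in Table 3.1) and PROVES all six
conditions for each of them by finite computation; odd moments are discharged through the antipodal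
symmetry `c_{σ i} = −c_i`, `w_{σ i} = w_i` of each set.  No named facts.

## References
* [KrugerEtAl2017] T. Krüger, H. Kusumaatmaja, A. Kuzmin, O. Shardt, G. Silva, E. M. Viggen,
  *The Lattice Boltzmann Method: Principles and Practice*, Springer (2017),
  doi:10.1007/978-3-319-44649-3, §3.4.7.2 eq. (3.60) and §3.4.7.3 Tables 3.1–3.3 (PDF pp. 121–124 of the held copy).
-/

namespace Literature.MathematicalPhysics.KineticTheory.LatticeBoltzmann

open Finset

/-- A `DdQq` lattice Boltzmann velocity set: `q` lattice velocities `c i : Fin d → ℤ` with rational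
weights `w i` [cite: KrugerEtAl2017, §3.4.7.1–3.4.7.3, Table 3.1]. -/
structure VelocitySet (d q : ℕ) where
  /-- the discrete velocities `c_i ∈ ℤ^d` -/
  c : Fin q → Fin d → ℤ
  /-- the quadrature weights `w_i` -/
  w : Fin q → ℚ

namespace VelocitySet

variable {d q : ℕ}

/-- Kronecker delta as a rational number (the `δ_αβ` of eq. (3.60)) [cite: KrugerEtAl2017, §3.4.7.2 eq. (3.60)]. -/
def delta (a b : Fin d) : ℚ := if a = b then 1 else 0

/-- `δ_αα = 1` [folklore]. -/
@[simp] private lemma delta_self (a : Fin d) : delta a a = 1 := by simp [delta]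

/-- `δ_αβ = 0` for `α ≠ β` [folklore]. -/
private lemma delta_of_ne {a b : Fin d} (h : a ≠ b) : delta a b = 0 := by simp [delta, h]

/-- Antipodal symmetry kills odd moments: if a permutation `σ` of the index set flips the sign of a
summand, the sum vanishes (the mechanism behind the odd rows of eq. (3.60)) [folklore]. -/
private theorem sum_eq_zero_of_antipodal (σ : Equiv.Perm (Fin q)) (f : Fin q → ℚ)
    (hf : ∀ i, f (σ i) = -f i) : ∑ i, f i = 0 := by
  have h : ∑ i, f (σ i) = ∑ i, f i := Equiv.sum_comp σ f
  have h' : ∑ i, f (σ i) = -∑ i, f i := by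
    rw [← Finset.sum_neg_distrib]; exact Finset.sum_congr rfl fun i _ => hf i
  linarith

/-- The quadratic form of the second moments: if `∑ w_i c_iα c_iβ = c_s² δ_αβ` then for every real
vector `v`, `∑_i w_i (c_i · v)² = c_s² ‖v‖²` — the form in which second-moment isotropy enters the
equilibrium/moment computations [cite: KrugerEtAl2017, §3.4.7.2 eq. (3.60) (third line)]. -/
theorem sum_w_mul_dot_sq (V : VelocitySet d q) (cs2 : ℚ)
    (h2 : ∀ a b, ∑ i, V.w i * (V.c i a * V.c i b) = cs2 * delta a b) (v : Fin d → ℝ) :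
    ∑ i, (V.w i : ℝ) * (∑ a, (V.c i a : ℝ) * v a) ^ 2 = (cs2 : ℝ) * ∑ a, v a ^ 2 := by
  have key : ∀ a b : Fin d, ∑ i, (V.w i : ℝ) * ((V.c i a : ℝ) * (V.c i b : ℝ))
      = (cs2 : ℝ) * (if a = b then 1 else 0) := by
    intro a b
    have := congrArg (fun x : ℚ => (x : ℝ)) (h2 a b)
    by_cases hab : a = b
    · subst hab; simpa [delta, Rat.cast_sum] using this
    · simpa [delta, hab, Rat.cast_sum] using this
  calc ∑ i, (V.w i : ℝ) * (∑ a, (V.c i a : ℝ) * v a) ^ 2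
      = ∑ i, ∑ a, ∑ b, (V.w i : ℝ) * ((V.c i a : ℝ) * (V.c i b : ℝ)) * (v a * v b) := by
        refine Finset.sum_congr rfl fun i _ => ?_
        rw [sq, Finset.sum_mul_sum, Finset.mul_sum]
        refine Finset.sum_congr rfl fun a _ => ?_
        rw [Finset.mul_sum]
        refine Finset.sum_congr rfl fun b _ => ?_
        ring
    _ = ∑ a, ∑ b, (∑ i, (V.w i : ℝ) * ((V.c i a : ℝ) * (V.c i b : ℝ))) * (v a * v b) := by
        rw [Finset.sum_comm]
        refine Finset.sum_congr rfl fun a _ => ?_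
        rw [Finset.sum_comm]
        refine Finset.sum_congr rfl fun b _ => ?_
        rw [Finset.sum_mul]
    _ = ∑ a, (cs2 : ℝ) * (v a * v a) := by
        refine Finset.sum_congr rfl fun a _ => ?_
        simp_rw [key]
        simp [Finset.sum_ite_eq]
    _ = (cs2 : ℝ) * ∑ a, v a ^ 2 := by
        rw [Finset.mul_sum]; refine Finset.sum_congr rfl fun a _ => ?_; ring

end VelocitySet

/-! ## D1Q3 (Table 3.2) -/

/-- The D1Q3 velocity set: `c = (0, +1, −1)`, `w = (2/3, 1/6, 1/6)` [cite: KrugerEtAl2017, §3.4.7.3 Table 3.2]. -/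
def D1Q3 : VelocitySet 1 3 where
  c := ![![0], ![1], ![-1]]
  w := ![2/3, 1/6, 1/6]

namespace D1Q3

/-- `∑ w_i = 1` for D1Q3 [cite: KrugerEtAl2017, §3.4.7.2 eq. (3.60); §3.4.7.3 Table 3.2]. -/
theorem sum_w : ∑ i, D1Q3.w i = 1 := by
  simp [D1Q3, Fin.sum_univ_succ]; norm_num

/-- `w_i > 0` for D1Q3 [cite: KrugerEtAl2017, §3.4.7.3 Table 3.2]. -/
theorem w_pos (i : Fin 3) : 0 < D1Q3.w i := by
  fin_cases i <;> simp [D1Q3]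

/-- Second moment `∑ w_i c_i² = 1/3 = c_s²` for D1Q3 [cite: KrugerEtAl2017, §3.4.7.2 eq. (3.60); §3.4.7.3 Table 3.1]. -/
theorem moment2 (a b : Fin 1) : ∑ i, D1Q3.w i * (D1Q3.c i a * D1Q3.c i b) = (1/3 : ℚ) * VelocitySet.delta a b := by
  fin_cases a; fin_cases b
  simp [D1Q3, Fin.sum_univ_succ, VelocitySet.delta]; norm_num

/-- Fourth moment `∑ w_i c_i⁴ = 1/3 = 3 c_s⁴` for D1Q3 [cite: KrugerEtAl2017, §3.4.7.2 eq. (3.60); §3.4.7.3 Table 3.1]. -/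
theorem moment4 (a b e f : Fin 1) :
    ∑ i, D1Q3.w i * (D1Q3.c i a * D1Q3.c i b * D1Q3.c i e * D1Q3.c i f)
      = (1/3 : ℚ) ^ 2 * (VelocitySet.delta a b * VelocitySet.delta e f
          + VelocitySet.delta a e * VelocitySet.delta b f + VelocitySet.delta a f * VelocitySet.delta b e) := by
  fin_cases a; fin_cases b; fin_cases e; fin_cases f
  simp [D1Q3, Fin.sum_univ_succ, VelocitySet.delta]; norm_num

/-- First moments vanish for D1Q3 [cite: KrugerEtAl2017, §3.4.7.2 eq. (3.60)]. -/
theorem moment1 (a : Fin 1) : ∑ i, D1Q3.w i * D1Q3.c i a = 0 := by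
  fin_cases a; simp [D1Q3, Fin.sum_univ_succ]

/-- Third moments vanish for D1Q3 [cite: KrugerEtAl2017, §3.4.7.2 eq. (3.60)]. -/
theorem moment3 (a b e : Fin 1) : ∑ i, D1Q3.w i * (D1Q3.c i a * D1Q3.c i b * D1Q3.c i e) = 0 := by
  fin_cases a; fin_cases b; fin_cases e; simp [D1Q3, Fin.sum_univ_succ]

/-- Fifth moments vanish for D1Q3 [cite: KrugerEtAl2017, §3.4.7.2 eq. (3.60)]. -/
theorem moment5 (a b e f g : Fin 1) :
    ∑ i, D1Q3.w i * (D1Q3.c i a * D1Q3.c i b * D1Q3.c i e * D1Q3.c i f * D1Q3.c i g) = 0 := by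
  fin_cases a; fin_cases b; fin_cases e; fin_cases f; fin_cases g; simp [D1Q3, Fin.sum_univ_succ]

end D1Q3

/-! ## D2Q9 (Table 3.3) -/

/-- The D2Q9 velocity set in the explicit order of Table 3.3: rest velocity (weight 4/9), the four
axis velocities `(±1,0), (0,±1)` (weight 1/9), the four diagonals `(±1,±1)` (weight 1/36)
[cite: KrugerEtAl2017, §3.4.7.3 Table 3.3]. -/
def D2Q9 : VelocitySet 2 9 where
  c := ![![0, 0], ![1, 0], ![0, 1], ![-1, 0], ![0, -1], ![1, 1], ![-1, 1], ![-1, -1], ![1, -1]]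
  w := ![4/9, 1/9, 1/9, 1/9, 1/9, 1/36, 1/36, 1/36, 1/36]

namespace D2Q9

/-- The antipodal map `i ↦ σ i` with `c_{σ i} = −c_i` on D2Q9 (indices of Table 3.3) [folklore]. -/
def antipode : Equiv.Perm (Fin 9) where
  toFun := ![0, 3, 4, 1, 2, 7, 8, 5, 6]
  invFun := ![0, 3, 4, 1, 2, 7, 8, 5, 6]
  left_inv := by intro i; fin_cases i <;> rfl
  right_inv := by intro i; fin_cases i <;> rfl

/-- `c_{σ i} = −c_i` for the D2Q9 antipodal map [folklore]. -/
private lemma c_antipode (i : Fin 9) (a : Fin 2) : D2Q9.c (antipode i) a = -D2Q9.c i a := by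
  fin_cases i <;> fin_cases a <;> rfl

/-- `w_{σ i} = w_i` for the D2Q9 antipodal map [folklore]. -/
private lemma w_antipode (i : Fin 9) : D2Q9.w (antipode i) = D2Q9.w i := by
  fin_cases i <;> rfl

/-- `∑ w_i = 1` for D2Q9 [cite: KrugerEtAl2017, §3.4.7.2 eq. (3.60); §3.4.7.3 Table 3.3]. -/
theorem sum_w : ∑ i, D2Q9.w i = 1 := by
  simp [D2Q9, Fin.sum_univ_succ]; norm_num

/-- `w_i > 0` for D2Q9 [cite: KrugerEtAl2017, §3.4.7.3 Table 3.3]. -/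
theorem w_pos (i : Fin 9) : 0 < D2Q9.w i := by
  fin_cases i <;> simp [D2Q9]

/-- First moments vanish, `∑ w_i c_iα = 0`, for D2Q9 [cite: KrugerEtAl2017, §3.4.7.2 eq. (3.60)]. -/
theorem moment1 (a : Fin 2) : ∑ i, D2Q9.w i * D2Q9.c i a = 0 :=
  VelocitySet.sum_eq_zero_of_antipodal antipode _ fun i => by
    rw [w_antipode, c_antipode]; push_cast; ring

/-- Second-moment isotropy `∑ w_i c_iα c_iβ = c_s² δ_αβ` with `c_s² = 1/3` for D2Q9
[cite: KrugerEtAl2017, §3.4.7.2 eq. (3.60); §3.4.7.3 Table 3.1]. -/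
theorem moment2 (a b : Fin 2) :
    ∑ i, D2Q9.w i * (D2Q9.c i a * D2Q9.c i b) = (1/3 : ℚ) * VelocitySet.delta a b := by
  fin_cases a <;> fin_cases b <;> simp [D2Q9, Fin.sum_univ_succ, VelocitySet.delta] <;> norm_num

/-- Third moments vanish for D2Q9 [cite: KrugerEtAl2017, §3.4.7.2 eq. (3.60)]. -/
theorem moment3 (a b e : Fin 2) : ∑ i, D2Q9.w i * (D2Q9.c i a * D2Q9.c i b * D2Q9.c i e) = 0 :=
  VelocitySet.sum_eq_zero_of_antipodal antipode _ fun i => by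
    rw [w_antipode, c_antipode, c_antipode, c_antipode]; push_cast; ring

/-- Fourth-moment isotropy `∑ w_i c_iα c_iβ c_iγ c_iμ = c_s⁴ (δ_αβ δ_γμ + δ_αγ δ_βμ + δ_αμ δ_βγ)` with
`c_s⁴ = 1/9` for D2Q9 [cite: KrugerEtAl2017, §3.4.7.2 eq. (3.60); §3.4.7.3 Table 3.1]. -/
theorem moment4 (a b e f : Fin 2) :
    ∑ i, D2Q9.w i * (D2Q9.c i a * D2Q9.c i b * D2Q9.c i e * D2Q9.c i f)
      = (1/3 : ℚ) ^ 2 * (VelocitySet.delta a b * VelocitySet.delta e f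
          + VelocitySet.delta a e * VelocitySet.delta b f + VelocitySet.delta a f * VelocitySet.delta b e) := by
  fin_cases a <;> fin_cases b <;> fin_cases e <;> fin_cases f <;>
    simp [D2Q9, Fin.sum_univ_succ, VelocitySet.delta] <;> norm_num

/-- Fifth moments vanish for D2Q9 [cite: KrugerEtAl2017, §3.4.7.2 eq. (3.60)]. -/
theorem moment5 (a b e f g : Fin 2) :
    ∑ i, D2Q9.w i * (D2Q9.c i a * D2Q9.c i b * D2Q9.c i e * D2Q9.c i f * D2Q9.c i g) = 0 :=
  VelocitySet.sum_eq_zero_of_antipodal antipode _ fun i => by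
    rw [w_antipode, c_antipode, c_antipode, c_antipode, c_antipode, c_antipode]; push_cast; ring

/-- The quadratic form: `∑ w_i (c_i · v)² = ‖v‖²/3` for every `v ∈ ℝ²` (D2Q9)
[cite: KrugerEtAl2017, §3.4.7.2 eq. (3.60)]. -/
theorem sum_w_mul_dot_sq (v : Fin 2 → ℝ) :
    ∑ i, (D2Q9.w i : ℝ) * (∑ a, (D2Q9.c i a : ℝ) * v a) ^ 2 = (1/3 : ℝ) * ∑ a, v a ^ 2 := by
  have := VelocitySet.sum_w_mul_dot_sq D2Q9 (1/3) moment2 v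
  simpa using this

end D2Q9

/-! ## D3Q27 (tensor product of D1Q3; Table 3.1 weights) -/

/-- The D3Q27 velocity set, constructed as the tensor product `D1Q3 ⊗ D1Q3 ⊗ D1Q3` (index
`i = 9 jₓ + 3 j_y + j_z` with the D1Q3 order `0, +1, −1` on each axis; weight = product of the D1Q3
weights): rest velocity 8/27, the 6 face velocities 2/27, the 12 edge velocities 1/54, the 8 corner
velocities 1/216 [cite: KrugerEtAl2017, §3.4.7.3 Table 3.1 (D3Q27 rows); §3.4.7.2 (tensor-product construction)]. -/
def D3Q27 : VelocitySet 3 27 where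
  c := ![![0, 0, 0], ![0, 0, 1], ![0, 0, -1], ![0, 1, 0], ![0, 1, 1], ![0, 1, -1], ![0, -1, 0],
    ![0, -1, 1], ![0, -1, -1], ![1, 0, 0], ![1, 0, 1], ![1, 0, -1], ![1, 1, 0], ![1, 1, 1], ![1, 1, -1],
    ![1, -1, 0], ![1, -1, 1], ![1, -1, -1], ![-1, 0, 0], ![-1, 0, 1], ![-1, 0, -1], ![-1, 1, 0],
    ![-1, 1, 1], ![-1, 1, -1], ![-1, -1, 0], ![-1, -1, 1], ![-1, -1, -1]]
  w := ![8/27, 2/27, 2/27, 2/27, 1/54, 1/54, 2/27, 1/54, 1/54, 2/27, 1/54, 1/54, 1/54, 1/216, 1/216,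
    1/54, 1/216, 1/216, 2/27, 1/54, 1/54, 1/54, 1/216, 1/216, 1/54, 1/216, 1/216]

namespace D3Q27

/-- The weights are the products of the D1Q3 weights along the three axes (tensor-product
construction) [cite: KrugerEtAl2017, §3.4.7.2]. -/
theorem w_eq_prod (jx jy jz : Fin 3) :
    D3Q27.w ⟨9 * jx.val + 3 * jy.val + jz.val, by omega⟩ = D1Q3.w jx * D1Q3.w jy * D1Q3.w jz := by
  fin_cases jx <;> fin_cases jy <;> fin_cases jz <;> simp [D3Q27, D1Q3] <;> norm_num

/-- The velocities are the triples of D1Q3 velocities (tensor-product construction)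
[cite: KrugerEtAl2017, §3.4.7.2]. -/
theorem c_eq_prod (jx jy jz : Fin 3) :
    D3Q27.c ⟨9 * jx.val + 3 * jy.val + jz.val, by omega⟩ = ![D1Q3.c jx 0, D1Q3.c jy 0, D1Q3.c jz 0] := by
  fin_cases jx <;> fin_cases jy <;> fin_cases jz <;> rfl

/-- The antipodal map `c_{σ i} = −c_i` on D3Q27 (axis-wise swap of `+1 ↔ −1`) [folklore]. -/
def antipode : Equiv.Perm (Fin 27) where
  toFun := ![0, 2, 1, 6, 8, 7, 3, 5, 4, 18, 20, 19, 24, 26, 25, 21, 23, 22, 9, 11, 10, 15, 17, 16, 12, 14, 13]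
  invFun := ![0, 2, 1, 6, 8, 7, 3, 5, 4, 18, 20, 19, 24, 26, 25, 21, 23, 22, 9, 11, 10, 15, 17, 16, 12, 14, 13]
  left_inv := by intro i; fin_cases i <;> rfl
  right_inv := by intro i; fin_cases i <;> rfl

/-- `c_{σ i} = −c_i` for the D3Q27 antipodal map [folklore]. -/
private lemma c_antipode (i : Fin 27) (a : Fin 3) : D3Q27.c (antipode i) a = -D3Q27.c i a := by
  fin_cases i <;> fin_cases a <;> rfl

/-- `w_{σ i} = w_i` for the D3Q27 antipodal map [folklore]. -/
private lemma w_antipode (i : Fin 27) : D3Q27.w (antipode i) = D3Q27.w i := by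
  fin_cases i <;> rfl

/-- `∑ w_i = 1` for D3Q27 [cite: KrugerEtAl2017, §3.4.7.2 eq. (3.60); §3.4.7.3 Table 3.1]. -/
theorem sum_w : ∑ i, D3Q27.w i = 1 := by
  simp [D3Q27, Fin.sum_univ_succ]; norm_num

/-- `w_i > 0` for D3Q27 [cite: KrugerEtAl2017, §3.4.7.3 Table 3.1]. -/
theorem w_pos (i : Fin 27) : 0 < D3Q27.w i := by
  fin_cases i <;> simp [D3Q27]

/-- First moments vanish, `∑ w_i c_iα = 0`, for D3Q27 [cite: KrugerEtAl2017, §3.4.7.2 eq. (3.60)]. -/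
theorem moment1 (a : Fin 3) : ∑ i, D3Q27.w i * D3Q27.c i a = 0 :=
  VelocitySet.sum_eq_zero_of_antipodal antipode _ fun i => by
    rw [w_antipode, c_antipode]; push_cast; ring

/-- Second-moment isotropy `∑ w_i c_iα c_iβ = c_s² δ_αβ` with `c_s² = 1/3` for D3Q27
[cite: KrugerEtAl2017, §3.4.7.2 eq. (3.60); §3.4.7.3 Table 3.1]. -/
theorem moment2 (a b : Fin 3) :
    ∑ i, D3Q27.w i * (D3Q27.c i a * D3Q27.c i b) = (1/3 : ℚ) * VelocitySet.delta a b := by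
  -- 9 index pairs × 27 velocities: a finite computation over ℚ, checked by the kernel
  revert a b; decide +kernel

/-- Third moments vanish for D3Q27 [cite: KrugerEtAl2017, §3.4.7.2 eq. (3.60)]. -/
theorem moment3 (a b e : Fin 3) : ∑ i, D3Q27.w i * (D3Q27.c i a * D3Q27.c i b * D3Q27.c i e) = 0 :=
  VelocitySet.sum_eq_zero_of_antipodal antipode _ fun i => by
    rw [w_antipode, c_antipode, c_antipode, c_antipode]; push_cast; ring

/-- Fourth-moment isotropy `∑ w_i c_iα c_iβ c_iγ c_iμ = c_s⁴ (δ_αβ δ_γμ + δ_αγ δ_βμ + δ_αμ δ_βγ)` with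
`c_s⁴ = 1/9` for D3Q27 [cite: KrugerEtAl2017, §3.4.7.2 eq. (3.60); §3.4.7.3 Table 3.1]. -/
theorem moment4 (a b e f : Fin 3) :
    ∑ i, D3Q27.w i * (D3Q27.c i a * D3Q27.c i b * D3Q27.c i e * D3Q27.c i f)
      = (1/3 : ℚ) ^ 2 * (VelocitySet.delta a b * VelocitySet.delta e f
          + VelocitySet.delta a e * VelocitySet.delta b f + VelocitySet.delta a f * VelocitySet.delta b e) := by
  -- 81 index quadruples × 27 velocities: a finite computation over ℚ, checked by the kernel
  revert a b e f; decide +kernel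

/-- Fifth moments vanish for D3Q27 [cite: KrugerEtAl2017, §3.4.7.2 eq. (3.60)]. -/
theorem moment5 (a b e f g : Fin 3) :
    ∑ i, D3Q27.w i * (D3Q27.c i a * D3Q27.c i b * D3Q27.c i e * D3Q27.c i f * D3Q27.c i g) = 0 :=
  VelocitySet.sum_eq_zero_of_antipodal antipode _ fun i => by
    rw [w_antipode, c_antipode, c_antipode, c_antipode, c_antipode, c_antipode]; push_cast; ring

/-- The quadratic form: `∑ w_i (c_i · v)² = ‖v‖²/3` for every `v ∈ ℝ³` (D3Q27)
[cite: KrugerEtAl2017, §3.4.7.2 eq. (3.60)]. -/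
theorem sum_w_mul_dot_sq (v : Fin 3 → ℝ) :
    ∑ i, (D3Q27.w i : ℝ) * (∑ a, (D3Q27.c i a : ℝ) * v a) ^ 2 = (1/3 : ℝ) * ∑ a, v a ^ 2 := by
  have := VelocitySet.sum_w_mul_dot_sq D3Q27 (1/3) moment2 v
  simpa using this

end D3Q27

end Literature.MathematicalPhysics.KineticTheory.LatticeBoltzmann
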